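import Summits.CriticalPhenomena.PercolationContinuityZ3.Theorems.PercNearOneGluingNoHeavyQuantFarSunGame
import Mathlib.Tactic.IntervalCases
import HarnessLib

/-!
# FAR beyond trees: REGION II CERTIFICATES `K = 12`, cells [19/100, 1/4) and [1/4, 27/100) (plain budget games)

builds on p205010 (kernel theorem, internal audit signed; external expert review pending)

Support file (`--supports stmt-CriticalPhenomena-4575`), seat `prim-cert-1` (gen 39); memo `prim-cert-1/FROM-prim-cert-1-g39-VERTEX-GAME.md` §7 (revised).
COMPUTATIONAL (`native_decide`).  THE LAST OPEN CASE `K = 12` OF LAYER 2: Region II (least hair weight `η ∈ (0.19, 1/3)` on `R`) is cut into six cells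
`[19/100,1/4) [1/4,27/100) [27/100,3/10) [3/10,31/100) [31/100,8/25) [8/25,1/3)`; the first certified budget `B_min = ⌊S/u⌋ + 1` of a cell `[lo,hi)` is matched
to the slab bound `Σh > S` valid on `R` (start `Σ > 1 + 2/hi` from `η(Σ−1) > 2`, then the θ = 1/4 Chernoff ladder `1 − F ≤ 16·e^{−3Σ/4} ≤ 16·0.8291^{4s}`,
seat folder work/dpc/plan12e.py, plan12e.json).  All instances were verified exactly beforehand (int128 engine xgalphl2.c: every listed budget meets its threshold,
worst margin exactly 0 at the strata budgets).
These two lowest cells pass with the 5-letter alphabet `{lo, 2/5, 3/5, 4/5, 1}` (unit `1/5`) and no `R`-slack term (`gameCert`, as in …CertCells13 &c.).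
Consumed by `HairyCycle.witGavg_ge_one_of_cellGame` (…LayerTwoMid) in …LayerTwoMid12.  Elementary [this work]; no sorries; axioms standard + `Lean.ofReduceBool`.
-/

namespace Summit.CriticalPhenomena.PercolationContinuityZ3.Theorems.HairyCycle

/-- Region II certificate `K = 12`, cell `η ∈ [19/100, 1/4)`: letters `['19/100', '2/5', '3/5', '4/5', '1']` over `q = 100`, weights `[2, 3, 4, 5, 5]` (unit `1/5`),
caps `(9, 2, 3)`, `Lpay = 180`; budgets `50 … 60` (slab bound `Σ > 4957/500 ≈ 9.914`). [this work] -/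
theorem cellCert_12_0 : (⟨9, 2, 3, 12, 100, 180, [(19, 2), (40, 3), (60, 4), (80, 5), (100, 5)]⟩ : GameSpec).gameCert 60 12 (List.range' 50 11) = true := by
  native_decide

/-- Its specification is well formed. [this work] -/
theorem cellWF_12_0 : (⟨9, 2, 3, 12, 100, 180, [(19, 2), (40, 3), (60, 4), (80, 5), (100, 5)]⟩ : GameSpec).WF where
  q_pos := by decide
  k_le := by
    intro i hi
    have : i < 5 := hi
    interval_cases i <;> decide
  Kcred4 := by decide
  Lpay_pos := by decide
  dvdA := by
    intro d h1 h2
    change d + 4 ≤ 9 at h2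
    have h3 : d ≤ 5 := by omega
    interval_cases d <;> decide
  dvdK := by decide

/-- Region II certificate `K = 12`, cell `η ∈ [1/4, 27/100)`: letters `['1/4', '2/5', '3/5', '4/5', '1']` over `q = 20`, weights `[2, 3, 4, 5, 5]` (unit `1/5`),
caps `(9, 2, 3)`, `Lpay = 180`; budgets `47 … 60` (slab bound `Σ > 9291/1000 ≈ 9.291`). [this work] -/
theorem cellCert_12_1 : (⟨9, 2, 3, 12, 20, 180, [(5, 2), (8, 3), (12, 4), (16, 5), (20, 5)]⟩ : GameSpec).gameCert 60 12 (List.range' 47 14) = true := by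
  native_decide

/-- Its specification is well formed. [this work] -/
theorem cellWF_12_1 : (⟨9, 2, 3, 12, 20, 180, [(5, 2), (8, 3), (12, 4), (16, 5), (20, 5)]⟩ : GameSpec).WF where
  q_pos := by decide
  k_le := by
    intro i hi
    have : i < 5 := hi
    interval_cases i <;> decide
  Kcred4 := by decide
  Lpay_pos := by decide
  dvdA := by
    intro d h1 h2
    change d + 4 ≤ 9 at h2
    have h3 : d ≤ 5 := by omega
    interval_cases d <;> decide
  dvdK := by decide

end Summit.CriticalPhenomena.PercolationContinuityZ3.Theorems.HairyCycle
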